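import Summits.AtomisticToContinuum.Crystallization.Theorems.ThreeConeCertificateSlackRigidityPricedFloorsDefs
import Literature.Geometry.DiscreteGeometry.LayerStackings

/-!
# Globalisation of exact local layerings, I: integer codes of the layered patterns

Helper file 1 for the stub `stub_globalize` of the line `priced-floors-palm-exactification`
(crux `ThreeConeCertificate.SlackRigidity`, item 11960).  The exact local-to-global layer lemma
(Hales, *Dense Sphere Packings* §1.3, layer induction) is proved for the admissible layered
family `layeredSet A a s z` of item 13958 by reducing all pattern combinatorics to decidable
statements about integer codes: the lateral vector `(p/3) u_a + (q/3) v_a` is coded by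
`(p, q) ∈ ℤ × ℤ` (`lat a (p, q)`), so that the in-plane lattice is `3ℤ × 3ℤ`, the hexagon of first
neighbours is `hexCodes`, and the three points of an adjacent layer nearest to a site sit over the
holes `upCodes σ` of type `σ = ±1`.  This file: the codes, the coordinate/norm formulae, and the
first-shell pattern `shellSet a σ₁ t₁ σ₂ t₂` (hexagon at height `0`, a hole triple of type `σ₁` at
height `t₁`, a hole triple of type `σ₂` at height `t₂`).  All `[folklore]`.
-/

noncomputable section

open Set
open Literature.MathematicalPhysics.StatisticalMechanics
open Summit.AtomisticToContinuum.Crystallization.Theorems.SlackRigidityPricedFloors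

namespace Summit.AtomisticToContinuum.Crystallization.Theorems.SlackRigidityPricedFloorsGlobalize

/-! ## Lateral codes -/

/-- The lateral vector with integer code `c = (p, q)`: `(p/3) u_a + (q/3) v_a`, where
`u_a = (a, 0, 0)`, `v_a = (a/2, a√3/2, 0)`. -/
def lat (a : ℝ) (c : ℤ × ℤ) : E3 := !₂[a * (2 * c.1 + c.2) / 6, a * √3 * c.2 / 6, 0]

/-- The vertical unit vector `e₃`. -/
def e3 : E3 := !₂[0, 0, 1]

/-- The triangular quadratic form `p² + pq + q²` of a code. -/
def Qf (c : ℤ × ℤ) : ℤ := c.1 ^ 2 + c.1 * c.2 + c.2 ^ 2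

variable {a : ℝ}

/-- Coordinates of a coded point. [folklore] -/
@[simp] theorem lat_add_smul_apply_zero (a : ℝ) (c : ℤ × ℤ) (t : ℝ) :
    (lat a c + t • e3) 0 = a * (2 * c.1 + c.2) / 6 := by
  simp [lat, e3]

/-- Coordinates of a coded point. [folklore] -/
@[simp] theorem lat_add_smul_apply_one (a : ℝ) (c : ℤ × ℤ) (t : ℝ) :
    (lat a c + t • e3) 1 = a * √3 * c.2 / 6 := by
  simp [lat, e3]

/-- Coordinates of a coded point. [folklore] -/
@[simp] theorem lat_add_smul_apply_two (a : ℝ) (c : ℤ × ℤ) (t : ℝ) :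
    (lat a c + t • e3) 2 = t := by
  simp [lat, e3]

/-- `lat` is additive in the code. [folklore] -/
theorem lat_add (a : ℝ) (c c' : ℤ × ℤ) : lat a (c + c') = lat a c + lat a c' := by
  ext i; fin_cases i <;> simp [lat] <;> ring

/-- `lat` is odd in the code. [folklore] -/
theorem lat_neg (a : ℝ) (c : ℤ × ℤ) : lat a (-c) = -lat a c := by
  ext i; fin_cases i <;> simp [lat] <;> ring

/-- `lat` of a difference. [folklore] -/
theorem lat_sub (a : ℝ) (c c' : ℤ × ℤ) : lat a (c - c') = lat a c - lat a c' := by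
  rw [sub_eq_add_neg, lat_add, lat_neg, sub_eq_add_neg]

/-- `lat 0 = 0`. [folklore] -/
@[simp] theorem lat_zero (a : ℝ) : lat a 0 = 0 := by
  ext i; fin_cases i <;> simp [lat]

/-- Sum of two coded points. [folklore] -/
theorem coded_add (a : ℝ) (c c' : ℤ × ℤ) (t t' : ℝ) :
    (lat a c + t • e3) + (lat a c' + t' • e3) = lat a (c + c') + (t + t') • e3 := by
  rw [lat_add, add_smul]; abel

/-- Negative of a coded point. [folklore] -/
theorem coded_neg (a : ℝ) (c : ℤ × ℤ) (t : ℝ) :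
    -(lat a c + t • e3) = lat a (-c) + (-t) • e3 := by
  rw [lat_neg, neg_smul]; abel

/-- A lateral vector is the coded point of height `0`. [folklore] -/
theorem lat_eq_coded (a : ℝ) (c : ℤ × ℤ) : lat a c = lat a c + (0 : ℝ) • e3 := by simp

/-- **Squared norm of a coded point**: `‖(p/3)u + (q/3)v + t e₃‖² = a²(p²+pq+q²)/9 + t²`.
[folklore] -/
theorem norm_coded_sq (a : ℝ) (c : ℤ × ℤ) (t : ℝ) :
    ‖lat a c + t • e3‖ ^ 2 = a ^ 2 / 9 * Qf c + t ^ 2 := by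
  rw [Literature.Geometry.DiscreteGeometry.norm_sq_fin3, lat_add_smul_apply_zero,
    lat_add_smul_apply_one, lat_add_smul_apply_two, Qf]
  have h3 : (√3 : ℝ) ^ 2 = 3 := Real.sq_sqrt (by norm_num)
  push_cast
  linear_combination (a ^ 2 * (c.2 : ℝ) ^ 2 / 36) * h3

/-- Squared norm of a lateral vector. [folklore] -/
theorem norm_lat_sq (a : ℝ) (c : ℤ × ℤ) : ‖lat a c‖ ^ 2 = a ^ 2 / 9 * Qf c := by
  simpa using norm_coded_sq a c 0

/-- **Coded points determine their codes** (`a ≠ 0`). [folklore] -/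
theorem coded_inj (ha : a ≠ 0) {c c' : ℤ × ℤ} {t t' : ℝ} :
    lat a c + t • e3 = lat a c' + t' • e3 ↔ c = c' ∧ t = t' := by
  constructor
  · intro h
    have h0 := congrArg (fun x : E3 => x 0) h
    have h1 := congrArg (fun x : E3 => x 1) h
    have h2 := congrArg (fun x : E3 => x 2) h
    simp only [lat_add_smul_apply_zero, lat_add_smul_apply_one, lat_add_smul_apply_two] at h0 h1 h2
    have hs : (√3 : ℝ) ≠ 0 := by positivity
    have e2 : (c.2 : ℝ) = c'.2 := by
      have := mul_right_cancel₀ (show a * √3 / 6 ≠ 0 by positivity)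
        (show (c.2 : ℝ) * (a * √3 / 6) = c'.2 * (a * √3 / 6) by linarith)
      exact this
    have e1 : (c.1 : ℝ) = c'.1 := by
      rw [e2] at h0
      have := mul_right_cancel₀ (show a / 3 ≠ 0 by positivity)
        (show (c.1 : ℝ) * (a / 3) = c'.1 * (a / 3) by linarith)
      exact this
    exact ⟨Prod.ext (by exact_mod_cast e1) (by exact_mod_cast e2), h2⟩
  · rintro ⟨rfl, rfl⟩; rfl

/-- Lateral vectors determine their codes. [folklore] -/
theorem lat_inj (ha : a ≠ 0) {c c' : ℤ × ℤ} : lat a c = lat a c' ↔ c = c' := by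
  rw [lat_eq_coded a c, lat_eq_coded a c', coded_inj ha]; simp

/-! ## Bridge to the vocabulary of `BarlowStacking.lean` -/

/-- `u_a = lat (3, 0)`. [folklore] -/
theorem triangularVec₁_eq (a : ℝ) : triangularVec₁ a = lat a (3, 0) := by
  ext i; fin_cases i <;> norm_num [lat, triangularVec₁]

/-- `v_a = lat (0, 3)`. [folklore] -/
theorem triangularVec₂_eq (a : ℝ) : triangularVec₂ a = lat a (0, 3) := by
  ext i; fin_cases i <;> norm_num [lat, triangularVec₂] <;> ring

/-- `w_a = lat (1, 1)`. [folklore] -/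
theorem barlowOffset_eq (a : ℝ) : barlowOffset a = lat a (1, 1) := by
  ext i; fin_cases i <;> norm_num [lat, barlowOffset]
  ring

/-- `layerNormal 1 = e₃`. [folklore] -/
theorem layerNormal_one : layerNormal 1 = e3 := rfl

/-- **The layered-set parametrisation in codes**:
`i u + j v + L w + t e₃ = lat (3i + L, 3j + L) + t e₃`. [folklore] -/
theorem combo_eq (a : ℝ) (i j L : ℤ) (t : ℝ) :
    (i : ℝ) • triangularVec₁ a + (j : ℝ) • triangularVec₂ a + (L : ℝ) • barlowOffset a +
      t • layerNormal 1 = lat a (3 * i + L, 3 * j + L) + t • e3 := by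
  ext k; fin_cases k <;>
    simp [lat, e3, triangularVec₁, triangularVec₂, barlowOffset, layerNormal] <;> ring

/-! ## The code sets -/

/-- Codes of the six in-plane first neighbours `±u, ±v, ±(u − v)`. -/
def hexCodes : Finset (ℤ × ℤ) := {(3, 0), (-3, 0), (0, 3), (0, -3), (3, -3), (-3, 3)}

/-- Codes of the three holes of type `σ` nearest to a site: `σ w, σ(w − u), σ(w − v)`. -/
def upCodes (σ : ℤ) : Finset (ℤ × ℤ) := {(σ, σ), (-2 * σ, σ), (σ, -2 * σ)}

/-- The two signs, as a finset (for `decide`). -/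
def signs : Finset ℤ := {1, -1}

/-- Membership in `signs`. [folklore] -/
theorem mem_signs {σ : ℤ} : σ ∈ signs ↔ σ = 1 ∨ σ = -1 := by simp [signs]

/-- `#hexCodes = 6`. [folklore] -/
theorem card_hexCodes : hexCodes.card = 6 := by decide

/-- `#upCodes σ = 3`. [folklore] -/
theorem card_upCodes {σ : ℤ} (hσ : σ = 1 ∨ σ = -1) : (upCodes σ).card = 3 := by
  rcases hσ with rfl | rfl <;> decide

/-- In-plane neighbours have `Q = 9` (norm `a`). [folklore] -/
theorem Qf_of_mem_hexCodes {c : ℤ × ℤ} (hc : c ∈ hexCodes) : Qf c = 9 := by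
  revert c hc; decide

/-- Hole codes have `Q = 3` (lateral norm `a/√3`). [folklore] -/
theorem Qf_of_mem_upCodes {σ : ℤ} (hσ : σ = 1 ∨ σ = -1) {c : ℤ × ℤ} (hc : c ∈ upCodes σ) :
    Qf c = 3 := by
  have key : ∀ σ ∈ signs, ∀ c ∈ upCodes σ, Qf c = 3 := by decide
  exact key σ (mem_signs.2 hσ) c hc

/-- The hexagon is centrally symmetric. [folklore] -/
theorem neg_mem_hexCodes {c : ℤ × ℤ} (hc : c ∈ hexCodes) : -c ∈ hexCodes := by
  revert c hc; decide

/-- Holes of type `σ` reflect to holes of type `−σ`. [folklore] -/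
theorem neg_mem_upCodes {σ : ℤ} (hσ : σ = 1 ∨ σ = -1) {c : ℤ × ℤ} (hc : c ∈ upCodes σ) :
    -c ∈ upCodes (-σ) := by
  have key : ∀ σ ∈ signs, ∀ c ∈ upCodes σ, -c ∈ upCodes (-σ) := by decide
  exact key σ (mem_signs.2 hσ) c hc

/-- **An antipodal pair of hole points has opposite types.** [folklore] -/
theorem upCodes_antipodal {σ₁ σ₂ : ℤ} (h₁ : σ₁ = 1 ∨ σ₁ = -1) (h₂ : σ₂ = 1 ∨ σ₂ = -1)
    {c : ℤ × ℤ} (hc : c ∈ upCodes σ₁) (hc' : -c ∈ upCodes σ₂) : σ₂ = -σ₁ := by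
  have key : ∀ σ₁ ∈ signs, ∀ σ₂ ∈ signs, ∀ c ∈ upCodes σ₁, -c ∈ upCodes σ₂ → σ₂ = -σ₁ := by
    decide
  exact key σ₁ (mem_signs.2 h₁) σ₂ (mem_signs.2 h₂) c hc hc'

/-- Hole codes are not in-plane codes. [folklore] -/
theorem not_mem_hexCodes_of_mem_upCodes {σ : ℤ} (hσ : σ = 1 ∨ σ = -1) {c : ℤ × ℤ}
    (hc : c ∈ upCodes σ) : c ∉ hexCodes := by
  intro h; have := Qf_of_mem_hexCodes h; rw [Qf_of_mem_upCodes hσ hc] at this; omega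

/-- **A short difference of two hexagon vectors is a hexagon vector.** [folklore] -/
theorem hex_sub_hex {c₁ c₂ : ℤ × ℤ} (h₁ : c₁ ∈ hexCodes) (h₂ : c₂ ∈ hexCodes)
    (hQ : Qf (c₁ - c₂) < 27) : c₁ = c₂ ∨ c₁ - c₂ ∈ hexCodes := by
  have key : ∀ c₁ ∈ hexCodes, ∀ c₂ ∈ hexCodes, Qf (c₁ - c₂) < 27 → c₁ = c₂ ∨ c₁ - c₂ ∈ hexCodes := by
    decide
  exact key c₁ h₁ c₂ h₂ hQ

/-- In-plane codes are lattice codes `(3i, 3j)`. [folklore] -/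
theorem exists_eq_of_mem_hexCodes {c : ℤ × ℤ} (hc : c ∈ hexCodes) :
    ∃ i j : ℤ, c = (3 * i, 3 * j) := by
  have key : ∀ c ∈ hexCodes, 3 ∣ c.1 ∧ 3 ∣ c.2 := by decide
  obtain ⟨⟨i, hi⟩, ⟨j, hj⟩⟩ := key c hc
  exact ⟨i, j, Prod.ext hi hj⟩

/-- Hole codes of type `σ` are `(3i + σ, 3j + σ)`. [folklore] -/
theorem exists_eq_of_mem_upCodes {σ : ℤ} (hσ : σ = 1 ∨ σ = -1) {c : ℤ × ℤ} (hc : c ∈ upCodes σ) :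
    ∃ i j : ℤ, c = (3 * i + σ, 3 * j + σ) := by
  have key : ∀ σ ∈ signs, ∀ c ∈ upCodes σ, 3 ∣ c.1 - σ ∧ 3 ∣ c.2 - σ := by decide
  obtain ⟨⟨i, hi⟩, ⟨j, hj⟩⟩ := key σ (mem_signs.2 hσ) c hc
  exact ⟨i, j, Prod.ext (by simp; omega) (by simp; omega)⟩

/-- `(σ, σ) ∈ upCodes σ`. [folklore] -/
theorem diag_mem_upCodes (σ : ℤ) : (σ, σ) ∈ upCodes σ := by simp [upCodes]

/-- `(3,0), (0,3) ∈ hexCodes` and friends. [folklore] -/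
theorem mem_hexCodes_basic : (3, 0) ∈ hexCodes ∧ (-3, 0) ∈ hexCodes ∧ (0, 3) ∈ hexCodes ∧
    (0, -3) ∈ hexCodes ∧ (3, -3) ∈ hexCodes ∧ (-3, 3) ∈ hexCodes := by decide

/-! ## The first-shell pattern -/

/-- The coded points `lat c + t e₃`, `c ∈ C`, at height `t`. -/
def shellPart (a : ℝ) (C : Finset (ℤ × ℤ)) (t : ℝ) : Set E3 :=
  (fun c : ℤ × ℤ => lat a c + t • e3) '' (C : Set (ℤ × ℤ))

/-- **First-shell pattern**: the in-plane hexagon, a hole triple of type `σ₁` at height `t₁` and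
a hole triple of type `σ₂` at height `t₂`. -/
def shellSet (a : ℝ) (σ₁ : ℤ) (t₁ : ℝ) (σ₂ : ℤ) (t₂ : ℝ) : Set E3 :=
  shellPart a hexCodes 0 ∪ shellPart a (upCodes σ₁) t₁ ∪ shellPart a (upCodes σ₂) t₂

/-- Membership of a coded point in a shell part. [folklore] -/
theorem coded_mem_shellPart_iff (ha : a ≠ 0) {C : Finset (ℤ × ℤ)} {c : ℤ × ℤ} {t t' : ℝ} :
    lat a c + t • e3 ∈ shellPart a C t' ↔ c ∈ C ∧ t = t' := by
  constructor
  · rintro ⟨c', hc', h⟩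
    obtain ⟨rfl, rfl⟩ := (coded_inj ha).1 h
    exact ⟨hc', rfl⟩
  · rintro ⟨hc, rfl⟩
    exact ⟨c, hc, rfl⟩

/-- Members of a shell part are coded points. [folklore] -/
theorem exists_of_mem_shellPart {C : Finset (ℤ × ℤ)} {t : ℝ} {v : E3} (hv : v ∈ shellPart a C t) :
    ∃ c ∈ C, v = lat a c + t • e3 := by
  obtain ⟨c, hc, rfl⟩ := hv; exact ⟨c, hc, rfl⟩

/-- **Membership of a coded point in the shell pattern.** [folklore] -/
theorem coded_mem_shellSet_iff (ha : a ≠ 0) {σ₁ σ₂ : ℤ} {t₁ t₂ : ℝ} {c : ℤ × ℤ} {t : ℝ} :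
    lat a c + t • e3 ∈ shellSet a σ₁ t₁ σ₂ t₂ ↔
      (c ∈ hexCodes ∧ t = 0) ∨ (c ∈ upCodes σ₁ ∧ t = t₁) ∨ (c ∈ upCodes σ₂ ∧ t = t₂) := by
  simp only [shellSet, Set.mem_union, coded_mem_shellPart_iff ha, or_assoc]

/-- Members of the shell pattern are coded points. [folklore] -/
theorem exists_of_mem_shellSet {σ₁ σ₂ : ℤ} {t₁ t₂ : ℝ} {v : E3} (hv : v ∈ shellSet a σ₁ t₁ σ₂ t₂) :
    ∃ (c : ℤ × ℤ) (t : ℝ), v = lat a c + t • e3 ∧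
      ((c ∈ hexCodes ∧ t = 0) ∨ (c ∈ upCodes σ₁ ∧ t = t₁) ∨ (c ∈ upCodes σ₂ ∧ t = t₂)) := by
  rcases hv with (hv | hv) | hv <;> obtain ⟨c, hc, rfl⟩ := exists_of_mem_shellPart hv
  · exact ⟨c, 0, rfl, Or.inl ⟨hc, rfl⟩⟩
  · exact ⟨c, _, rfl, Or.inr (Or.inl ⟨hc, rfl⟩)⟩
  · exact ⟨c, _, rfl, Or.inr (Or.inr ⟨hc, rfl⟩)⟩

/-- The two hole triples play symmetric roles. [folklore] -/
theorem shellSet_comm (a : ℝ) (σ₁ : ℤ) (t₁ : ℝ) (σ₂ : ℤ) (t₂ : ℝ) :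
    shellSet a σ₁ t₁ σ₂ t₂ = shellSet a σ₂ t₂ σ₁ t₁ := by
  simp only [shellSet, Set.union_assoc, Set.union_comm (shellPart a (upCodes σ₁) t₁)]

/-- Lateral vectors of the hexagon are in the pattern. [folklore] -/
theorem lat_mem_shellSet {σ₁ σ₂ : ℤ} {t₁ t₂ : ℝ} {c : ℤ × ℤ} (hc : c ∈ hexCodes) :
    lat a c ∈ shellSet a σ₁ t₁ σ₂ t₂ :=
  Or.inl (Or.inl ⟨c, hc, by simp⟩)

/-- A shell part is finite, of cardinality `#C`. [folklore] -/
theorem ncard_shellPart (ha : a ≠ 0) (C : Finset (ℤ × ℤ)) (t : ℝ) :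
    (shellPart a C t).ncard = C.card := by
  rw [shellPart, Set.ncard_image_of_injective _ (fun c c' h => ((coded_inj ha).1 h).1),
    Set.ncard_coe_finset]

/-- A shell part is finite. [folklore] -/
theorem shellPart_finite (a : ℝ) (C : Finset (ℤ × ℤ)) (t : ℝ) : (shellPart a C t).Finite :=
  (C.finite_toSet).image _

/-- The shell pattern is finite. [folklore] -/
theorem shellSet_finite (a : ℝ) (σ₁ : ℤ) (t₁ : ℝ) (σ₂ : ℤ) (t₂ : ℝ) :
    (shellSet a σ₁ t₁ σ₂ t₂).Finite :=
  ((shellPart_finite _ _ _).union (shellPart_finite _ _ _)).union (shellPart_finite _ _ _)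

/-- **The shell pattern has twelve points** (distinct nonzero heights of the triples).
[folklore] -/
theorem ncard_shellSet (ha : a ≠ 0) {σ₁ σ₂ : ℤ} (h₁ : σ₁ = 1 ∨ σ₁ = -1) (h₂ : σ₂ = 1 ∨ σ₂ = -1)
    {t₁ t₂ : ℝ} (ht₁ : t₁ ≠ 0) (ht₂ : t₂ ≠ 0) (h12 : t₁ ≠ t₂) :
    (shellSet a σ₁ t₁ σ₂ t₂).ncard = 12 := by
  have d1 : Disjoint (shellPart a hexCodes 0) (shellPart a (upCodes σ₁) t₁) := by
    rw [Set.disjoint_left]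
    rintro _ ⟨c, hc, rfl⟩ h
    exact ht₁ ((coded_mem_shellPart_iff ha).1 h).2.symm
  have d2 : Disjoint (shellPart a hexCodes 0 ∪ shellPart a (upCodes σ₁) t₁)
      (shellPart a (upCodes σ₂) t₂) := by
    rw [Set.disjoint_left]
    rintro _ (⟨c, hc, rfl⟩ | ⟨c, hc, rfl⟩) h
    · exact ht₂ ((coded_mem_shellPart_iff ha).1 h).2.symm
    · exact h12 ((coded_mem_shellPart_iff ha).1 h).2
  rw [shellSet, Set.ncard_union_eq d2 ((shellPart_finite _ _ _).union (shellPart_finite _ _ _))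
    (shellPart_finite _ _ _), Set.ncard_union_eq d1 (shellPart_finite _ _ _) (shellPart_finite _ _ _),
    ncard_shellPart ha, ncard_shellPart ha, ncard_shellPart ha, card_hexCodes, card_upCodes h₁,
    card_upCodes h₂]

/-! ## Further vocabulary used by the later helper files -/

/-- Rotation of a code by `60°`: `u ↦ v ↦ v − u`. -/
def rot (c : ℤ × ℤ) : ℤ × ℤ := (-c.2, c.1 + c.2)

/-- The point `(m, i, j)` of the standard layered set: `i u + j v + L_m w + z_m e₃`. -/
def pt (a : ℝ) (s : ℤ → ℤ) (z : ℤ → ℝ) (m i j : ℤ) : E3 :=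
  lat a (3 * i + haggLabel s m, 3 * j + haggLabel s m) + z m • e3

/-- The standard layered set (`layeredSet` in the frame `A = id`). -/
def stdL (a : ℝ) (s : ℤ → ℤ) (z : ℤ → ℝ) : Set E3 := {p | ∃ m i j : ℤ, p = pt a s z m i j}

/-- Codes of the unit hexagon `±u/3, …` (the hexagon codes divided by `3`). -/
def unitHex : Finset (ℤ × ℤ) := {(1, 0), (-1, 0), (0, 1), (0, -1), (1, -1), (-1, 1)}

/-- The twelve symmetries of the hexagon as pairs of columns `(d₁, d₂)` (images of `u/3`,
`v/3`). -/
def hexMats : Finset ((ℤ × ℤ) × (ℤ × ℤ)) :=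
  (unitHex ×ˢ unitHex).filter (fun d => ((3 * (d.1.1 - d.2.1), 3 * (d.1.2 - d.2.2)) : ℤ × ℤ) ∈ hexCodes)

/-- Action of a hexagon symmetry on codes. -/
def mapM (d : (ℤ × ℤ) × (ℤ × ℤ)) (c : ℤ × ℤ) : ℤ × ℤ :=
  (c.1 * d.1.1 + c.2 * d.2.1, c.1 * d.1.2 + c.2 * d.2.2)

/-- The type sign of a hexagon symmetry: `+1` if it preserves the hole types, `−1` if it swaps
them. -/
def typeSign (d : (ℤ × ℤ) × (ℤ × ℤ)) : ℤ := if (upCodes 1).image (mapM d) = upCodes 1 then 1 else -1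

/-- **The first shell of a configuration** `S` at `y`: the offsets `θ` with `y + θ ∈ S` and
`0 < ‖θ‖ ≤ 28/25`. -/
def nbr (S : Set E3) (y : E3) : Set E3 := {θ | y + θ ∈ S ∧ 0 < ‖θ‖ ∧ ‖θ‖ ≤ 28 / 25}

/-- **Main statement of this file**: the first-shell pattern has exactly twelve points.
[folklore] -/
theorem globalize_ncard_shellSet : ∀ (a : ℝ), a ≠ 0 → ∀ (σ₁ σ₂ : ℤ), (σ₁ = 1 ∨ σ₁ = -1) → (σ₂ = 1 ∨ σ₂ = -1) → ∀ (t₁ t₂ : ℝ), t₁ ≠ 0 → t₂ ≠ 0 → t₁ ≠ t₂ → (shellSet a σ₁ t₁ σ₂ t₂).ncard = 12 :=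
  fun _ ha _ _ h₁ h₂ _ _ ht₁ ht₂ h12 => ncard_shellSet ha h₁ h₂ ht₁ ht₂ h12

end Summit.AtomisticToContinuum.Crystallization.Theorems.SlackRigidityPricedFloorsGlobalize

end
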